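import Literature.Topology.PlanarFoliations.ProngStarEnds
import HarnessLib

/-!
# Prong tails of separatrices

Topic: Topology / PlanarFoliations, sequel to `ProngStarEnds.lean`. A **forward prong tail** of an
open leaf `L` at an `n`-prong star `P` at the puncture `v` is the datum produced by
`ProngStar.exists_fwd_eq_prong`: a sector `j`, a point `p ∈ L` over the prong point `pt j (β₀, 0)`
and the identification of the forward half-leaf of `p` with the points over the initial arc
`{pt j (β, 0) | 0 < β ≤ β₀}` of the prong; a **backward prong tail** likewise
(`ProngStar.FwdTail`, `ProngStar.BwdTail`, **structures**; `nonempty_fwdTail`,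
`nonempty_bwdTail` when the ω- resp. α-limit set is `{v}`). We add what the walks along separatrix
graphs use:

* `FwdTail.exists_mem_fwd`, `BwdTail.exists_mem_bwd` (**proved**): **every point of the initial
  arc is attained** — the sector coordinate on the (connected) half-leaf takes the value `β₀` and
  values arbitrarily close to `0` (the half-leaf accumulates at `v`), hence every value in
  between;
* `FwdTail.lift_mem_leaf`, `BwdTail.lift_mem_leaf` (**proved**): so the points of `X` over the
  initial arc lie on the leaf;
* `exists_leafPath` (**proved**, any foliation): two points of one leaf are joined by a path of the
  ambient space continuous in the leaf topology (`Foliation.exists_path_of_mem_leaf`), which gives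
  the links of the walks between prong points of one separatrix.

## References

* C. Camacho, A. Lins Neto, *Geometric Theory of Foliations*, Birkhäuser (1985), Ch. VII §2
  [CamachoLinsNeto1985].
-/

noncomputable section

open Set Filter Function Metric unitInterval
open _root_.Topology
open Literature.Topology.FourManifolds Literature.Topology.FourManifolds.Foliation

namespace Literature.Topology.PlanarFoliations

/-! ## Leaf paths between two points of a leaf -/

/-- **Two points of one leaf are joined by a path continuous in the leaf topology.** [folklore] -/
theorem exists_leafPath {B : Type*} [NormedAddCommGroup B] [NormedSpace ℝ B] {M : Type*} [TopologicalSpace M]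
    {F : Foliation B M} [Nonempty B] {x y : M} (hy : y ∈ F.leaf x) :
    ∃ ℓ : Path x y, Continuous (toLeafSpace ∘ ℓ : I → F.LeafSpace) := by
  obtain ⟨γ, -⟩ := F.exists_path_of_mem_leaf hy
  refine ⟨⟨⟨ofLeafSpace ∘ γ, F.continuous_ofLeafSpace.comp γ.continuous⟩, ?_, ?_⟩, ?_⟩
  · show ofLeafSpace (γ 0) = x; rw [γ.source]; rfl
  · show ofLeafSpace (γ 1) = y; rw [γ.target]; rfl
  · show Continuous fun s ↦ toLeafSpace (ofLeafSpace (γ s))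
    simp only [toLeafSpace_ofLeafSpace]
    exact γ.continuous

variable {X : Type*} [TopologicalSpace X] [T2Space X] [SecondCountableTopology X] {F : Foliation ℝ X} {ι : X → ℂ}
  {v : ℂ} {n : ℕ}

namespace ProngStar

variable (P : ProngStar F ι v n) (hι : IsOpenEmbedding ι) {x : X} [NoncompactSpace (F.Leaf x)] (hbi : IsBiOriented F)

/-! ## Forward prong tails -/

/-- **A forward prong tail** of the open leaf of `x` at the star `P`: the forward half-leaf of the
point `p` over `pt j (β₀, 0)` consists exactly of the points over the initial arc
`{pt j (β, 0) | 0 < β ≤ β₀}` of the prong of the sector `j`, and accumulates at `v`. [folklore] -/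
structure FwdTail (x : X) [NoncompactSpace (F.Leaf x)] where
  /-- the sector -/
  j : ZMod n
  /-- the base point of the tail -/
  p : F.Leaf x
  /-- the parameter of the base point -/
  β₀ : ℝ
  hβ₀ : β₀ ∈ Ioc 0 P.ρ
  hp : ι (Leaf.pt p) = P.pt j (β₀, 0)
  fwd_iff : ∀ q : F.Leaf x, q ∈ fwd hbi p ↔ ∃ β ∈ Ioc 0 β₀, ι (Leaf.pt q) = P.pt j (β, 0)
  mem_closure : v ∈ closure ((fun q : F.Leaf x ↦ ι (Leaf.pt q)) '' fwd hbi p)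

/-- **A backward prong tail** of the open leaf of `x` at the star `P`: the backward half-leaf of
the point `p` over `pt j (β₀, 0)` consists exactly of the points over the initial arc of the prong
of the sector `j`, and accumulates at `v`. [folklore] -/
structure BwdTail (x : X) [NoncompactSpace (F.Leaf x)] where
  /-- the sector -/
  j : ZMod n
  /-- the base point of the tail -/
  p : F.Leaf x
  /-- the parameter of the base point -/
  β₀ : ℝ
  hβ₀ : β₀ ∈ Ioc 0 P.ρ
  hp : ι (Leaf.pt p) = P.pt j (β₀, 0)
  bwd_iff : ∀ q : F.Leaf x, q ∈ bwd hbi p ↔ ∃ β ∈ Ioc 0 β₀, ι (Leaf.pt q) = P.pt j (β, 0)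
  mem_closure : v ∈ closure ((fun q : F.Leaf x ↦ ι (Leaf.pt q)) '' bwd hbi p)

variable {P hbi}

/-- **Forward prong tails exist** for a leaf in a compact set whose ω-limit set is `{v}`.
[cite: CamachoLinsNeto1985, Ch. VII §2] -/
theorem nonempty_fwdTail [NeZero n] (hι : IsOpenEmbedding ι) {C : Set ℂ} (hC : IsCompact C) (hmem : ∀ q : F.Leaf x, ι (Leaf.pt q) ∈ C)
    (hω : omegaSet hbi ι x = {v}) : Nonempty (P.FwdTail hbi x) := by
  obtain ⟨j, p, β₀, hβ₀, hp, hiff⟩ := P.exists_fwd_eq_prong hι (hbi := hbi) hC hmem hω.subset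
  have hv : v ∈ omegaSet hbi ι x := by rw [hω]; exact mem_singleton v
  exact ⟨⟨j, p, β₀, hβ₀, hp, hiff, (mem_omegaSet_iff.1 hv) p⟩⟩

namespace FwdTail

variable (E : P.FwdTail hbi x)

/-- The base point is in its forward half-leaf, with parameter `β₀`. [folklore] -/
theorem mem_S_of_mem_fwd {q : F.Leaf x} (hq : q ∈ fwd hbi E.p) :
    ∃ β ∈ Ioc 0 E.β₀, ι (Leaf.pt q) = P.pt E.j (β, 0) ∧ ι (Leaf.pt q) ∈ P.S E.j ∧ P.b E.j (ι (Leaf.pt q)) = β := by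
  obtain ⟨β, hβ, hq'⟩ := (E.fwd_iff q).1 hq
  have hrect : ((β, 0) : ℝ × ℝ) ∈ P.rect :=
    (P.mem_rect_iff).2 ⟨⟨hβ.1.le, hβ.2.trans E.hβ₀.2⟩, by simp [P.ρ_pos.le]⟩
  exact ⟨β, hβ, hq', by rw [hq']; exact P.pt_mem hrect, by rw [hq', P.b_pt hrect]⟩

/-- **Every point of the initial arc of the prong is attained by the forward half-leaf.**
[folklore] -/
theorem exists_mem_fwd (hι : IsOpenEmbedding ι) {β : ℝ} (hβ : β ∈ Ioc 0 E.β₀) :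
    ∃ q ∈ fwd hbi E.p, ι (Leaf.pt q) = P.pt E.j (β, 0) := by
  -- the sector coordinate along the forward half-leaf
  set c : F.Leaf x → ℝ := fun q ↦ P.b E.j (ι (Leaf.pt q)) with hc
  have hιpt : Continuous fun q : F.Leaf x ↦ ι (Leaf.pt q) := hι.continuous.comp (Leaf.continuous_coe F x)
  have hcont : ContinuousOn c (fwd hbi E.p) := by
    have hb : ContinuousOn (P.b E.j) (P.S E.j) := continuous_fst.comp_continuousOn (P.continuousOn_chart E.j)
    exact hb.comp hιpt.continuousOn fun q hq ↦ by obtain ⟨_, _, _, hS, _⟩ := E.mem_S_of_mem_fwd hq; exact hS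
  -- its image is preconnected, contains `β₀` and values below `β`
  have hconn : IsPreconnected (c '' fwd hbi E.p) := (PunctureData.isPreconnected_fwd E.p).image c hcont
  have hβ₀mem : E.β₀ ∈ c '' fwd hbi E.p := by
    refine ⟨E.p, mem_fwd_self E.p, ?_⟩
    have hrect : ((E.β₀, 0) : ℝ × ℝ) ∈ P.rect :=
      (P.mem_rect_iff).2 ⟨⟨E.hβ₀.1.le, E.hβ₀.2⟩, by simp [P.ρ_pos.le]⟩
    show P.b E.j (ι (Leaf.pt E.p)) = E.β₀
    rw [E.hp, P.b_pt hrect]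
  obtain ⟨ε, hε, hsmall⟩ := P.exists_norm_chart_lt E.j hβ.1
  obtain ⟨_, ⟨q₁, hq₁, rfl⟩, hdist⟩ : ∃ z ∈ (fun q : F.Leaf x ↦ ι (Leaf.pt q)) '' fwd hbi E.p, dist z v < ε := by
    have h := Metric.mem_closure_iff.1 E.mem_closure ε hε
    obtain ⟨z, hz, hd⟩ := h
    exact ⟨z, hz, by rwa [dist_comm] at hd⟩
  obtain ⟨β₁, hβ₁, -, hS₁, hb₁⟩ := E.mem_S_of_mem_fwd hq₁
  have hc₁ : c q₁ < β := by
    have h := hsmall _ hS₁ hdist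
    have h' : |P.b E.j (ι (Leaf.pt q₁))| ≤ ‖P.chart E.j (ι (Leaf.pt q₁))‖ := by
      rw [← Real.norm_eq_abs, P.chart_apply]; exact norm_fst_le (P.b E.j (ι (Leaf.pt q₁)), P.H (ι (Leaf.pt q₁)))
    exact (le_abs_self _).trans_lt (h'.trans_lt h)
  have hc₁mem : c q₁ ∈ c '' fwd hbi E.p := ⟨q₁, hq₁, rfl⟩
  -- hence `β` is attained
  obtain ⟨q, hq, hcq⟩ : β ∈ c '' fwd hbi E.p := hconn.Icc_subset hc₁mem hβ₀mem ⟨hc₁.le, hβ.2⟩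
  obtain ⟨β', -, hq', -, hb'⟩ := E.mem_S_of_mem_fwd hq
  refine ⟨q, hq, ?_⟩
  rw [hq', ← hb']
  exact congrArg (fun b ↦ P.pt E.j (b, 0)) hcq

/-- **The points of `X` over the initial arc of the prong lie on the leaf.** [folklore] -/
theorem lift_mem_leaf [Nonempty X] (hι : IsOpenEmbedding ι) {β : ℝ} (hβ : β ∈ Ioc 0 E.β₀) :
    ProngStar.lift hι (P.pt E.j (β, 0)) ∈ F.leaf x := by
  obtain ⟨q, -, hq⟩ := E.exists_mem_fwd hι hβ
  have hlift : ProngStar.lift hι (P.pt E.j (β, 0)) = Leaf.pt q := by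
    apply hι.injective
    rw [ProngStar.ι_lift hι ⟨Leaf.pt q, hq⟩, hq]
  rw [hlift]
  exact q.2

end FwdTail

/-! ## Backward prong tails -/

/-- **Backward prong tails exist** for a leaf in a compact set whose α-limit set is `{v}`.
[cite: CamachoLinsNeto1985, Ch. VII §2] -/
theorem nonempty_bwdTail [NeZero n] (hι : IsOpenEmbedding ι) {C : Set ℂ} (hC : IsCompact C) (hmem : ∀ q : F.Leaf x, ι (Leaf.pt q) ∈ C)
    (hα : alphaSet hbi ι x = {v}) : Nonempty (P.BwdTail hbi x) := by
  obtain ⟨j, p, β₀, hβ₀, hp, hiff⟩ := P.exists_bwd_eq_prong hι (hbi := hbi) hC hmem hα.subset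
  have hv : v ∈ alphaSet hbi ι x := by rw [hα]; exact mem_singleton v
  exact ⟨⟨j, p, β₀, hβ₀, hp, hiff, (mem_alphaSet_iff.1 hv) p⟩⟩

namespace BwdTail

variable (E : P.BwdTail hbi x)

/-- Points of the backward half-leaf lie over the initial arc, in the sector, with sector
coordinate their parameter. [folklore] -/
theorem mem_S_of_mem_bwd {q : F.Leaf x} (hq : q ∈ bwd hbi E.p) :
    ∃ β ∈ Ioc 0 E.β₀, ι (Leaf.pt q) = P.pt E.j (β, 0) ∧ ι (Leaf.pt q) ∈ P.S E.j ∧ P.b E.j (ι (Leaf.pt q)) = β := by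
  obtain ⟨β, hβ, hq'⟩ := (E.bwd_iff q).1 hq
  have hrect : ((β, 0) : ℝ × ℝ) ∈ P.rect :=
    (P.mem_rect_iff).2 ⟨⟨hβ.1.le, hβ.2.trans E.hβ₀.2⟩, by simp [P.ρ_pos.le]⟩
  exact ⟨β, hβ, hq', by rw [hq']; exact P.pt_mem hrect, by rw [hq', P.b_pt hrect]⟩

/-- **Every point of the initial arc of the prong is attained by the backward half-leaf.**
[folklore] -/
theorem exists_mem_bwd (hι : IsOpenEmbedding ι) {β : ℝ} (hβ : β ∈ Ioc 0 E.β₀) :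
    ∃ q ∈ bwd hbi E.p, ι (Leaf.pt q) = P.pt E.j (β, 0) := by
  set c : F.Leaf x → ℝ := fun q ↦ P.b E.j (ι (Leaf.pt q)) with hc
  have hιpt : Continuous fun q : F.Leaf x ↦ ι (Leaf.pt q) := hι.continuous.comp (Leaf.continuous_coe F x)
  have hcont : ContinuousOn c (bwd hbi E.p) := by
    have hb : ContinuousOn (P.b E.j) (P.S E.j) := continuous_fst.comp_continuousOn (P.continuousOn_chart E.j)
    exact hb.comp hιpt.continuousOn fun q hq ↦ by obtain ⟨_, _, _, hS, _⟩ := E.mem_S_of_mem_bwd hq; exact hS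
  have hconn : IsPreconnected (c '' bwd hbi E.p) := (PunctureData.isPreconnected_bwd E.p).image c hcont
  have hβ₀mem : E.β₀ ∈ c '' bwd hbi E.p := by
    refine ⟨E.p, mem_bwd_self E.p, ?_⟩
    have hrect : ((E.β₀, 0) : ℝ × ℝ) ∈ P.rect :=
      (P.mem_rect_iff).2 ⟨⟨E.hβ₀.1.le, E.hβ₀.2⟩, by simp [P.ρ_pos.le]⟩
    show P.b E.j (ι (Leaf.pt E.p)) = E.β₀
    rw [E.hp, P.b_pt hrect]
  obtain ⟨ε, hε, hsmall⟩ := P.exists_norm_chart_lt E.j hβ.1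
  obtain ⟨_, ⟨q₁, hq₁, rfl⟩, hdist⟩ : ∃ z ∈ (fun q : F.Leaf x ↦ ι (Leaf.pt q)) '' bwd hbi E.p, dist z v < ε := by
    obtain ⟨z, hz, hd⟩ := Metric.mem_closure_iff.1 E.mem_closure ε hε
    exact ⟨z, hz, by rwa [dist_comm] at hd⟩
  obtain ⟨β₁, hβ₁, -, hS₁, hb₁⟩ := E.mem_S_of_mem_bwd hq₁
  have hc₁ : c q₁ < β := by
    have h := hsmall _ hS₁ hdist
    have h' : |P.b E.j (ι (Leaf.pt q₁))| ≤ ‖P.chart E.j (ι (Leaf.pt q₁))‖ := by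
      rw [← Real.norm_eq_abs, P.chart_apply]; exact norm_fst_le (P.b E.j (ι (Leaf.pt q₁)), P.H (ι (Leaf.pt q₁)))
    exact (le_abs_self _).trans_lt (h'.trans_lt h)
  have hc₁mem : c q₁ ∈ c '' bwd hbi E.p := ⟨q₁, hq₁, rfl⟩
  obtain ⟨q, hq, hcq⟩ : β ∈ c '' bwd hbi E.p := hconn.Icc_subset hc₁mem hβ₀mem ⟨hc₁.le, hβ.2⟩
  obtain ⟨β', -, hq', -, hb'⟩ := E.mem_S_of_mem_bwd hq
  refine ⟨q, hq, ?_⟩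
  rw [hq', ← hb']
  exact congrArg (fun b ↦ P.pt E.j (b, 0)) hcq

/-- **The points of `X` over the initial arc of the prong lie on the leaf.** [folklore] -/
theorem lift_mem_leaf [Nonempty X] (hι : IsOpenEmbedding ι) {β : ℝ} (hβ : β ∈ Ioc 0 E.β₀) :
    ProngStar.lift hι (P.pt E.j (β, 0)) ∈ F.leaf x := by
  obtain ⟨q, -, hq⟩ := E.exists_mem_bwd hι hβ
  have hlift : ProngStar.lift hι (P.pt E.j (β, 0)) = Leaf.pt q := by
    apply hι.injective
    rw [ProngStar.ι_lift hι ⟨Leaf.pt q, hq⟩, hq]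
  rw [hlift]
  exact q.2

end BwdTail

end ProngStar

end Literature.Topology.PlanarFoliations
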